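import Mathlib

/-!
# night-2: the combinatorics of the side families

`W` a finite set, `U` (the side points) and `V` (the free points) disjoint subsets.  The `k`-subsets `Y` of `W`
that meet `U` and either meet `V` or contain two points of `U` number at least
`C(|W|, k) − C(|W| − |U|, k) − |U|·C(|W| − |U| − |V|, k − 1)`: the complement consists of the `Y` missing `U`
(`C(|W| − |U|, k)` of them) and the `Y` with exactly one point of `U` and none of `V` (`Y ↦ (the point, Y ∖ U)`
injects into `U × (the `(k − 1)`-subsets of `W ∖ (U ∪ V)`)`).  **`choose_le_card_filter_side_family`**.
Paper `proofs/NIGHT-2-g35.md` §2.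
-/

namespace PercRepro.Shadow

variable {α : Type*} [DecidableEq α]

/-- **The side family is large**: `C(|W|, k) ≤ #{Y : Y meets U ∧ (Y meets V ∨ |Y ∩ U| ≥ 2)} +
C(|W| − |U|, k) + |U|·C(|W| − |U| − |V|, k − 1)`. -/
theorem choose_le_card_filter_side_family (W U V : Finset α) (hU : U ⊆ W) (hV : V ⊆ W) (hUV : Disjoint U V)
    (k : ℕ) :
    W.card.choose k ≤
      ((W.powersetCard k).filter (fun Y => (Y ∩ U).Nonempty ∧ ((Y ∩ V).Nonempty ∨ 2 ≤ (Y ∩ U).card))).card +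
        (W.card - U.card).choose k + U.card * (W.card - U.card - V.card).choose (k - 1) := by
  set P := W.powersetCard k with hP
  set good := P.filter (fun Y => (Y ∩ U).Nonempty ∧ ((Y ∩ V).Nonempty ∨ 2 ≤ (Y ∩ U).card)) with hgood
  set bad := P.filter (fun Y => ¬ ((Y ∩ U).Nonempty ∧ ((Y ∩ V).Nonempty ∨ 2 ≤ (Y ∩ U).card))) with hbad
  have hsplit : good.card + bad.card = P.card := Finset.card_filter_add_card_filter_not (s := P) _
  have hPc : P.card = W.card.choose k := Finset.card_powersetCard k W
  -- the bad sets: missing `U`, or exactly one point of `U` and none of `V`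
  set bad₁ := (W \ U).powersetCard k with hbad₁
  set bad₂ := (U ×ˢ (W \ (U ∪ V)).powersetCard (k - 1)).image (fun p => insert p.1 p.2) with hbad₂
  have hcover : bad ⊆ bad₁ ∪ bad₂ := by
    intro Y hY
    rw [hbad, Finset.mem_filter, hP, Finset.mem_powersetCard] at hY
    obtain ⟨⟨hYW, hYk⟩, hnot⟩ := hY
    rw [Finset.mem_union]
    by_cases hYU : (Y ∩ U).Nonempty
    · right
      have hU1 : (Y ∩ U).card = 1 := by
        have h2 : ¬ 2 ≤ (Y ∩ U).card := fun h => hnot ⟨hYU, Or.inr h⟩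
        have h1 : 1 ≤ (Y ∩ U).card := Finset.card_pos.2 hYU
        omega
      obtain ⟨u, hu⟩ := Finset.card_eq_one.1 hU1
      have huY : u ∈ Y := (Finset.mem_inter.1 (by rw [hu]; exact Finset.mem_singleton_self u : u ∈ Y ∩ U)).1
      have huU : u ∈ U := (Finset.mem_inter.1 (by rw [hu]; exact Finset.mem_singleton_self u : u ∈ Y ∩ U)).2
      have hYV : ¬ (Y ∩ V).Nonempty := fun h => hnot ⟨hYU, Or.inl h⟩
      rw [hbad₂, Finset.mem_image]
      refine ⟨(u, Y \ U), ?_, ?_⟩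
      · rw [Finset.mem_product, Finset.mem_powersetCard]
        refine ⟨huU, ?_, ?_⟩
        · intro e he
          rw [Finset.mem_sdiff] at he ⊢
          refine ⟨hYW he.1, ?_⟩
          rw [Finset.mem_union, not_or]
          exact ⟨he.2, fun heV => hYV ⟨e, Finset.mem_inter.2 ⟨he.1, heV⟩⟩⟩
        · have := Finset.card_inter_add_card_sdiff Y U
          simp only
          omega
      · simp only
        ext e
        rw [Finset.mem_insert, Finset.mem_sdiff]
        constructor
        · rintro (rfl | ⟨he, -⟩)
          · exact huY
          · exact he
        · intro he
          by_cases heU : e ∈ U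
          · left
            have : e ∈ Y ∩ U := Finset.mem_inter.2 ⟨he, heU⟩
            rw [hu, Finset.mem_singleton] at this
            exact this
          · exact Or.inr ⟨he, heU⟩
    · left
      rw [hbad₁, Finset.mem_powersetCard]
      refine ⟨?_, hYk⟩
      intro e he
      rw [Finset.mem_sdiff]
      exact ⟨hYW he, fun heU => hYU ⟨e, Finset.mem_inter.2 ⟨he, heU⟩⟩⟩
  have h1 : bad₁.card = (W.card - U.card).choose k := by
    rw [hbad₁, Finset.card_powersetCard, Finset.card_sdiff_of_subset hU]
  have h2 : bad₂.card ≤ U.card * (W.card - U.card - V.card).choose (k - 1) := by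
    rw [hbad₂]
    refine (Finset.card_image_le).trans ?_
    rw [Finset.card_product, Finset.card_powersetCard]
    have hUVW : U ∪ V ⊆ W := Finset.union_subset hU hV
    rw [Finset.card_sdiff_of_subset hUVW, Finset.card_union_of_disjoint hUV, Nat.sub_sub]
  have h3 := Finset.card_le_card hcover
  have h4 := Finset.card_union_le bad₁ bad₂
  omega

end PercRepro.Shadow
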